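/-
Literature/AlgebraicGeometry/Pohlmann1968/MixedDifferenceCubeHodgeClasses.lean — pub-hodgecm2 (COR-CM), KEPT Literature lane
lit-deligne-3 gen 67, file F67a.  THEOREMS ONLY (no `def`, no named fact, no `sorry`, no instance, no notation; D-0026 net debt 0).
HC_CM is NOT proved.
-/
import Literature.AlgebraicGeometry.Pohlmann1968.NondegenerateCMTypeDivisorClasses
import HarnessLib

/-!
# Unions of fibres over a subfield as Hodge classes: the mixed-difference cube of a family of automorphisms of a CM
# subfield is Pohlmann-balanced iff the alternating sums of the restriction multiplicities vanish (Hazama's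
# nondivisorial cycles of codimension `2^{k-1}[K:F]`, for every admissible kernel of the degeneracy census)

Topic `Literature/AlgebraicGeometry/Pohlmann1968` (namespace `Literature.AlgebraicGeometry.Pohlmann1968.MixedDifferenceCube`); cell
`pub-hodgecm2` (COR-CM), KEPT Literature lane `lit-deligne-3` gen 67, file F67a.  KERNEL ONLY (theorems; D-0014 ∕ D-0026 net debt `0`).
HC_CM is NOT proved here or anywhere in the lane.

## Mathematics

SETTING.  `K` a CM field, `Φ ⊆ Hom(K, ℂ)` a CM type, `j : F → K` a subfield, `N(x) = #{φ ∈ Φ : φ|_F = x}` and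
`N'(x) = #{φ ∉ Φ : φ|_F = x}` the multiplicities of `Φ` and of `Φ̄` over `x ∈ Hom(F, ℂ)` (`N + N' = [K:F]`,
`N(x̄) = N'(x)`).  By H. Pohlmann's theorem [Pohlmann1968, Thm. 1] (tree `Pohlmann1968_thm1_holds`) the Hodge classes of
degree `2m` on a realisation `A` of `(K; Φ)` are spanned over `ℂ` by the weight vectors `e_Δ`, `Δ ⊆ Hom(K, ℂ)`, `|Δ| = 2m`,
with `|gΔ ∩ Φ| = |gΔ ∩ Φ̄|` for all `g ∈ Aut(ℂ)` (`pohlmannSets Φ m`), and the divisor classes by those `Δ` which are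
disjoint unions of balanced pairs (`pohlmannDivisorSets`; for a PRIMITIVE type the balanced pairs are the conjugate pairs,
tree `mem_pohlmannSets_one_iff_of_isPrimitive`, S. P. White [White1993SporadicCycles] Prop. 1).

(1) UNIONS OF FIBRES (`isGaloisBalanced_filter_comp_mem_iff`).  For a finite set `B ⊆ Hom(F, ℂ)` the union of fibres
`S_B = {φ : φ|_F ∈ B}` satisfies Pohlmann's condition iff `Σ_{b ∈ B} N(g ∘ b) = Σ_{b ∈ B} N'(g ∘ b)` for every `g ∈ Aut(ℂ)`
(an automorphism of `ℂ` carries the fibre over `b` onto the fibre over `g ∘ b`).  `|B| = 1` is the case of the tree's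
`WeilTypeCMSubfieldExceptionalClasses` (Weil classes relative to `F`: `Φ` equidistributed over `F`, B. Moonen, Yu. Zarhin,
*Weil classes on abelian varieties*; B. van Geemen 1994, 4.7; Deligne 1982 (4.4)).

(2) THE MIXED-DIFFERENCE CUBE (`isGaloisBalanced_iff_forall_ringEquiv`, `…_iff_forall_embedding`, `…_iff_forall_alternatingSum`).
Let `F` carry complex conjugation `c` (`x ∘ c = x̄` for every `x ∈ Hom(F, ℂ)`: `F` a CM field) and let `σ_i` (`i ∈ ι`, `|ι| = k`)
be commuting `ℚ`-automorphisms of `F`; for `ε ∈ {0,1}^ι` put `σ_ε = Π_{ε_i = 1} σ_i`, `s(ε) = (−1)^{|ε|}`, and for a base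
embedding `y ∈ Hom(F, ℂ)` let the CUBE be `X(y) = {y ∘ σ_ε : s(ε) = 1} ∪ {ȳ ∘ σ_ε : s(ε) = −1}` and `S(y) = S_{X(y)}` (for `k = 1`:
the two fibres over `y` and `ȳ ∘ σ`; Hazama's `w_k^{(2r)}` below).  Since `N(\overline{x}) = N'(x)`, the count of (1) over `X(y)`
is `Σ_ε s(ε)·(N − N')(g∘y∘σ_ε)`, so

  `S(y)` is Pohlmann-balanced ⟺ `Σ_ε (−1)^{|ε|} (N − N')(x ∘ σ_ε) = 0` for all `x = g ∘ y`, `g ∈ Aut(ℂ)` ⟺ (transitivity of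
  `Aut(ℂ)` on `Hom(F, ℂ)`) for ALL `x ∈ Hom(F, ℂ)` ⟺ (`k ≥ 1`, `N + N'` constant) `Σ_ε (−1)^{|ε|} N(x ∘ σ_ε) = 0` for all `x`

— the VANISHING OF THE MIXED DIFFERENCES OF THE MULTIPLICITIES OF `Φ|_F`, literally the field-side condition of the lane's
subfield dictionary (F66a `MixedDifferencesReading.forall_sum_card_filter_eq_zero_iff_mixed`, with `j = algebraMap F K`) which,
by the kernel decisions of the degeneracy census (F65e ∕ F66c ∕ F66j `…sum_char_eq_zero_iff_alternatingSum_…`: for `H = Gal(K/F)` of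
index `2^j·d`, cyclic quotient, `σ_i` running through the `p`-torsion of the odd part), is EQUIVALENT to `H` being an admissible
kernel (all characters of kernel `H` vanish on the type).  In words: **an admissible kernel of the census is witnessed ON `A` ITSELF by
the explicit Hodge classes `e_{S(y)}`, `y ∈ Hom(F, ℂ)`, of codimension `2^{k−1}[K:F]`** (`|S(y)| = 2^k [K:F]`), and conversely.
The condition does not depend on `y`: all cubes are Hodge or none is.

(3) NOT DIVISORIAL (`not_mem_pohlmannDivisorSets`, `exists_exceptional`, `one_le_finrank_sub`).  If `Φ` is primitive and no two
members of the cube `X(y)` are complex conjugate (e.g. the `σ_i` of odd orders with `ε ↦ σ_ε` injective), `S(y)` contains no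
conjugate pair, so it is not a disjoint union of balanced pairs: every realisation `A` of `(K; Φ)` carries a rational `(m,m)`-class
OUTSIDE `Dᵐ(A) ⊗ ℂ`, `2m = |S(y)|`, and `dim Bᵐ(A) − dim Dᵐ(A) ≥ 1` (the conjugate cube `\overline{S(y)} = S(ȳ)` is a second
witness; not counted here).

THE PRINT.  F. Hazama [Hazama2003CyclicCM] (cyclic CM fields of degree `2pq`), Prop. 3.2 (p. 586): the `ℤ`-basis
`w_k^{(2r)} = Σ_a g_k^{(2r)}(a)[a]`, `g = 1` on `a ≡ 0 (2r)`, `−1` on `a ≡ r (2r)`, `(−1)^{a−1}` on `a ≡ k (r)`, of `V_{2r} ∩ ℤ[ℤ/2n]`;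
§5 (pp. 596–597) with Thm. 4.8 (iv)–(vi) (p. 594): for a primitive degenerate type `S ∈ S_p − S_1` the proper Hodge cycles of
`A_S` correspond to `F⁻¹(w_k^{(2q)})`, «the weight of the inverses … are equal to `p` … Therefore the abelian variety `A` is
`p`-dominated. Furthermore the height of them are equal to one … `1`-degenerate», i.e. NONDIVISORIAL HODGE CYCLES OF CODIMENSION
`p` ON `A` ITSELF supported on `H ∪ (odd coset of H)`, `H` the subgroup of order `p` — the case `k = 1`, `F` of degree `2q`,
`[K:F] = p` of (2)–(3); Abstract: «we determine which CM-types … give rise to degenerate abelian varieties and in what codimension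
nondivisorial Hodge cycles exist on them».  S. P. White [White1993SporadicCycles] Prop. 1 ∕ §4: sporadic cycles ↔ odd
`{0, ±1}`-annihilators (tree `WhiteSporadicCriterion`): `1_{S(y)} − 1_{\overline{S(y)}}` is such an annihilator.  B. B. Gordon
[Gordon1999HodgeAVSurvey] 9.2.2 (the count `dim Bᵐ − dim Dᵐ`).  The general cube (any `k`, any CM field `K ⊇ F`) is the
lane's elementary extension of Hazama's `k = 1`; PRESEARCH: corpus hybrid «Hazama Hodge cycles N-dominated codimension
nondivisorial» → [corpus: paper:w2141840783 = Hazama 2003, pp. 1–2, 5–7, 14–17 read]; galaxy «N-dominated|nondivisorial Hodge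
cycle|sporadic cycles» all stars → 0 relevant; no printed source states the `k ≥ 2` cube — recorded as the lane's theorem with
Hazama cited for the mechanism.

## Contents (all `K` number field, `j : F →+* K` any ring map of fields; `Φ : CMType K`)

* §1 (private `ncard_filter_comp_mem_eq_sum`), **`isGaloisBalanced_filter_comp_mem_iff`** (unions of fibres), `ncard_conjugate_mem_eq`,
  `ncard_conjugate_not_mem_eq` (`N(x̄) = N'(x)`).
* §2 private auxiliaries (`sign_eq_one_or`, `ringEquiv_comp_conjugate`, `sum_sign_eq_zero`, `ncard_add_ncard_eq`: fibres have equal size); the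
  cube over `(σ, c, y)` with bases `b_ε`: `ncard_sub_ncard_eq_sign_mul`, **`isGaloisBalanced_iff_forall_ringEquiv`**,
  **`isGaloisBalanced_iff_forall_embedding`** (`F` a number field), **`isGaloisBalanced_iff_forall_alternatingSum`** (`ι` nonempty:
  F66a's shape), `mem_pohlmannSets_iff`.
* §3 `not_mem_pohlmannDivisorSets` (primitive `Φ`, conjugate-free cube), **`exists_exceptional`**, `one_le_finrank_sub`.
* §4 (private `comp_complexConj_eq_conjugate`), `isGaloisBalanced_iff_forall_alternatingSum_of_isCMField` (`c` = `IsCMField.complexConj F`).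
* §5 (gen 67 append): `conjugate_cube_eq`, `filter_comp_mem_image_conjugate` (`S(\overline{B}) = \overline{S(B)}`), **`two_le_finrank_sub`**
  (`dim Bᵐ(A) − dim Dᵐ(A) ≥ 2`: the cube and its conjugate are distinct exceptional lines).

HONEST REGISTER.  Elementary (counting fibres); the algebraicity of the classes `e_{S(y)}` is not touched (open in general; Hazama's
remark: it would imply the Hodge conjecture for all powers in the `2pq` case).  The link «alternating sums over `F` ⟺ admissible
kernel» is the lane's F65e ∕ F66a ∕ F66c ∕ F66j, cited by name, not restated.  HC_CM is NOT proved and not used.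

## References

* [Hazama2003CyclicCM] F. Hazama, *Hodge cycles on abelian varieties with complex multiplication by cyclic CM-fields*, J. Math. Sci.
  Univ. Tokyo 10 (2003) 581–598: Abstract, Prop. 2.4, Prop. 3.2, Thm. 4.8 (iv)–(vi), §5 (5.1)–(5.3).
* [Pohlmann1968] H. Pohlmann, *Algebraic cycles on abelian varieties of complex multiplication type*, Ann. of Math. 88 (1968), Thm. 1.
* [White1993SporadicCycles] S. P. White, *Sporadic cycles on CM abelian varieties*, Compositio Math. 88 (1993), §4 Prop. 1.
* [Gordon1999HodgeAVSurvey] B. B. Gordon, *A survey of the Hodge conjecture for abelian varieties*, §9.2, 9.2.2, 5.13 (ii).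
* [vanGeemen1994HodgeAV] B. van Geemen, *An introduction to the Hodge conjecture for abelian varieties*, LNM 1594 (1994), 4.7.

## Provenance

Cell `pub-hodgecm2` (COR-CM), KEPT Literature lane `lit-deligne-3` gen 67 (claim HAZAMA-COSET-CUBE-HODGE-CLASSES; count-neutral, own lane),
file F67a; neighbours cited by name, nothing restated: `HodgeClassesCMType` (`IsGaloisBalanced`, `pohlmannSets`,
`IsGaloisBalanced.card_eq_two_mul`), `DivisorClassesCMType` (`pohlmannDivisorSets_eq_of_pairs`, `exists_exceptional_iff`,
`finrank_hodgeClassSpan_sub_finrank_divisorClassesSpan`), `NondegenerateCMTypeDivisorClasses` (`mem_pohlmannSets_one_iff_of_isPrimitive`,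
`isPretransitive_ringEquiv_complex`), `WeilTypeCMSubfieldExceptionalClasses` (the case `|B| = 1`; its private transport lemma is
re-proved here privately).  Theorems only; net Literature debt 0.
-/

noncomputable section

open CategoryTheory NumberField
open scoped IsMulCommutative

namespace Literature.AlgebraicGeometry.Pohlmann1968

namespace MixedDifferenceCube

open Literature.NumberTheory.ComplexMultiplication
open Literature.AlgebraicGeometry.Motives (AbelianVariety CMType)
open Literature.AlgebraicGeometry.HodgeTheory
open Literature.AlgebraicGeometry.ComplexMultiplication (IsCMTypeRealisation)
open Literature.AlgebraicGeometry.VanGeemen1994 (hodgeClassSpan)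
open Literature.Barriers.HodgeConjecture (divisorClassesSpan)

open scoped Classical

/-! ## §1 Unions of fibres over a subfield -/

section Fibres

variable {K : Type} [Field K] {F : Type} [Field F] (j : F →+* K)

/-- An automorphism `g` of `ℂ` carries the fibre of `Hom(K, ℂ) → Hom(F, ℂ)` over `τ` bijectively onto the fibre over `g ∘ τ`.
(Re-proved privately; the tree's `WeilTypeCMSubfieldExceptionalClasses` has the same private lemma.) [folklore] -/
private theorem ncard_fibre_comp_eq (g : ℂ ≃+* ℂ) (τ : F →+* ℂ) (P : (K →+* ℂ) → Prop) :
    {φ : K →+* ℂ | φ.comp j = τ ∧ P ((g : ℂ →+* ℂ).comp φ)}.ncard =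
      {ψ : K →+* ℂ | ψ.comp j = (g : ℂ →+* ℂ).comp τ ∧ P ψ}.ncard := by
  have hinj : Function.Injective fun φ : K →+* ℂ => (g : ℂ →+* ℂ).comp φ := by
    intro φ φ' h
    refine RingHom.ext fun x => g.injective ?_
    have := DFunLike.congr_fun h x
    simpa using this
  have hgg : ∀ ψ : K →+* ℂ, (g : ℂ →+* ℂ).comp ((g.symm : ℂ →+* ℂ).comp ψ) = ψ := fun ψ =>
    RingHom.ext fun x => by simp
  have himage : {ψ : K →+* ℂ | ψ.comp j = (g : ℂ →+* ℂ).comp τ ∧ P ψ} =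
      (fun φ : K →+* ℂ => (g : ℂ →+* ℂ).comp φ) ''
        {φ : K →+* ℂ | φ.comp j = τ ∧ P ((g : ℂ →+* ℂ).comp φ)} := by
    ext ψ
    constructor
    · rintro ⟨h1, h2⟩
      refine ⟨(g.symm : ℂ →+* ℂ).comp ψ, ⟨?_, by rw [hgg ψ]; exact h2⟩, hgg ψ⟩
      rw [RingHom.comp_assoc, h1]
      exact RingHom.ext fun x => by simp
    · rintro ⟨φ, ⟨h1, h2⟩, rfl⟩
      exact ⟨by rw [RingHom.comp_assoc, h1], h2⟩
  rw [himage, Set.ncard_image_of_injective _ hinj]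

/-- Conjugation on the `ℂ` side commutes with restriction: `\overline{φ}|_F = \overline{φ|_F}`. [folklore] -/
private theorem conjugate_comp (φ : K →+* ℂ) :
    (ComplexEmbedding.conjugate φ).comp j = ComplexEmbedding.conjugate (φ.comp j) :=
  RingHom.ext fun _ => rfl

variable [NumberField K]

/-- **Counting over a union of fibres, fibrewise**: for a finite set `B` of embeddings of `F`, the members `φ` of
`S_B = {φ : φ|_F ∈ B}` with a property `P` are counted fibre by fibre. [folklore] -/
private theorem ncard_filter_comp_mem_eq_sum (B : Finset (F →+* ℂ)) (P : (K →+* ℂ) → Prop) :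
    {s : K →+* ℂ | s ∈ (Finset.univ.filter fun φ : K →+* ℂ => φ.comp j ∈ B) ∧ P s}.ncard =
      ∑ b ∈ B, {φ : K →+* ℂ | φ.comp j = b ∧ P φ}.ncard := by
  have hset : {s : K →+* ℂ | s ∈ (Finset.univ.filter fun φ : K →+* ℂ => φ.comp j ∈ B) ∧ P s} =
      ↑(Finset.univ.filter fun φ : K →+* ℂ => φ.comp j ∈ B ∧ P φ) := by
    ext s; simp
  rw [hset, Set.ncard_coe_finset,
    Finset.card_eq_sum_card_fiberwise (f := fun φ : K →+* ℂ => φ.comp j) (t := B)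
      (fun φ hφ => ((Finset.mem_filter.1 (Finset.mem_coe.1 hφ)).2).1)]
  refine Finset.sum_congr rfl fun b hb => ?_
  rw [← Set.ncard_coe_finset]
  congr 1
  ext φ
  simp only [Finset.coe_filter, Finset.mem_filter, Finset.mem_univ, true_and, Set.mem_setOf_eq]
  constructor
  · rintro ⟨⟨-, hP⟩, hb'⟩; exact ⟨hb', hP⟩
  · rintro ⟨hb', hP⟩; exact ⟨⟨by rw [hb']; exact hb, hP⟩, hb'⟩

variable {Φ : CMType K}

/-- **Unions of fibres and Pohlmann's condition.**  For a finite set `B ⊆ Hom(F, ℂ)` the union of fibres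
`S_B = {φ ∈ Hom(K, ℂ) : φ|_F ∈ B}` satisfies Pohlmann's Galois condition `|gS_B ∩ Φ| = |gS_B ∩ Φ̄|` (all `g ∈ Aut(ℂ)`) iff
`Σ_{b ∈ B} N(g ∘ b) = Σ_{b ∈ B} N'(g ∘ b)` for every `g`, where `N(x) = #{φ ∈ Φ : φ|_F = x}`, `N'(x) = #{φ ∉ Φ : φ|_F = x}`
(`gΔ_b = Δ_{g∘b}`).  `|B| = 1`: the tree's `isGaloisBalanced_fibre` (Weil classes relative to `F`).
[cite: Pohlmann1968, Thm. 1] [cite: Gordon1999HodgeAVSurvey, §9.2 (9.2.1)] -/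
theorem isGaloisBalanced_filter_comp_mem_iff (B : Finset (F →+* ℂ)) :
    IsGaloisBalanced Φ (Finset.univ.filter fun φ : K →+* ℂ => φ.comp j ∈ B) ↔
      ∀ g : ℂ ≃+* ℂ, ∑ b ∈ B, {φ : K →+* ℂ | φ.comp j = (g : ℂ →+* ℂ).comp b ∧ φ ∈ Φ.1}.ncard =
        ∑ b ∈ B, {φ : K →+* ℂ | φ.comp j = (g : ℂ →+* ℂ).comp b ∧ φ ∉ Φ.1}.ncard := by
  refine forall_congr' fun g => ?_
  rw [ncard_filter_comp_mem_eq_sum j B (fun s => (g : ℂ →+* ℂ).comp s ∈ Φ.1),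
    ncard_filter_comp_mem_eq_sum j B (fun s => (g : ℂ →+* ℂ).comp s ∉ Φ.1)]
  have h1 : ∀ b : F →+* ℂ, {φ : K →+* ℂ | φ.comp j = b ∧ (g : ℂ →+* ℂ).comp φ ∈ Φ.1}.ncard =
      {ψ : K →+* ℂ | ψ.comp j = (g : ℂ →+* ℂ).comp b ∧ ψ ∈ Φ.1}.ncard := fun b =>
    ncard_fibre_comp_eq j g b (· ∈ Φ.1)
  have h2 : ∀ b : F →+* ℂ, {φ : K →+* ℂ | φ.comp j = b ∧ (g : ℂ →+* ℂ).comp φ ∉ Φ.1}.ncard =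
      {ψ : K →+* ℂ | ψ.comp j = (g : ℂ →+* ℂ).comp b ∧ ψ ∉ Φ.1}.ncard := fun b =>
    ncard_fibre_comp_eq j g b (· ∉ Φ.1)
  simp only [h1, h2]

omit [NumberField K] in
/-- **Conjugate fibres**: the members of `Φ` over `x̄` are as many as the non-members over `x` (`φ ↦ φ̄` exchanges the fibres
over `x` and `x̄`, and `φ ∈ Φ ⟺ φ̄ ∉ Φ`): `N(x̄) = N'(x)`. [cite: Gordon1999HodgeAVSurvey, §9.2] -/
theorem ncard_conjugate_mem_eq (x : F →+* ℂ) :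
    {φ : K →+* ℂ | φ.comp j = ComplexEmbedding.conjugate x ∧ φ ∈ Φ.1}.ncard =
      {φ : K →+* ℂ | φ.comp j = x ∧ φ ∉ Φ.1}.ncard := by
  have hinv := ComplexEmbedding.involutive_conjugate K
  have himage : {φ : K →+* ℂ | φ.comp j = ComplexEmbedding.conjugate x ∧ φ ∈ Φ.1} =
      ComplexEmbedding.conjugate '' {φ : K →+* ℂ | φ.comp j = x ∧ φ ∉ Φ.1} := by
    ext φ
    constructor
    · rintro ⟨h1, h2⟩
      refine ⟨ComplexEmbedding.conjugate φ, ⟨?_, ?_⟩, hinv φ⟩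
      · rw [conjugate_comp, h1]; exact ComplexEmbedding.involutive_conjugate F x
      · exact (Φ.2 φ).1 h2
    · rintro ⟨ψ, ⟨h1, h2⟩, rfl⟩
      exact ⟨by rw [conjugate_comp, h1], not_not.1 ((Φ.2 ψ).not.1 h2)⟩
  rw [himage, Set.ncard_image_of_injective _ hinv.injective]

omit [NumberField K] in
/-- The symmetric statement: `N'(x̄) = N(x)`. [cite: Gordon1999HodgeAVSurvey, §9.2] -/
theorem ncard_conjugate_not_mem_eq (x : F →+* ℂ) :
    {φ : K →+* ℂ | φ.comp j = ComplexEmbedding.conjugate x ∧ φ ∉ Φ.1}.ncard =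
      {φ : K →+* ℂ | φ.comp j = x ∧ φ ∈ Φ.1}.ncard := by
  rw [← ncard_conjugate_mem_eq j (ComplexEmbedding.conjugate x), ComplexEmbedding.involutive_conjugate F x]

end Fibres

/-! ## §2 The mixed-difference cube of a family of automorphisms of the subfield -/

section Cube

variable {K : Type} [Field K] {F : Type} [Field F] (j : F →+* K) {Φ : CMType K} {ι : Type} [Fintype ι]

/-! ### Auxiliary: signs, conjugation, fibre sizes -/

/-- The sign `s(ε) = Π_i (ε_i ? −1 : 1) = (−1)^{|ε|}` is `1` or `−1`. [folklore] -/
private theorem sign_eq_one_or (ε : ι → Bool) :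
    (∏ i, (if ε i then (-1 : ℤ) else 1)) = 1 ∨ (∏ i, (if ε i then (-1 : ℤ) else 1)) = -1 := by
  refine Finset.prod_induction _ (fun z : ℤ => z = 1 ∨ z = -1) ?_ (Or.inl rfl) ?_
  · rintro a b (rfl | rfl) (rfl | rfl) <;> simp
  · intro i _
    by_cases h : ε i <;> simp [h]

omit [Fintype ι] in
/-- With complex conjugation `c` of `F` (`x ∘ c = x̄`): `g ∘ x̄ = \overline{g ∘ x}` for every `g ∈ Aut(ℂ)` and every embedding `x` of `F`
(both are `g ∘ x ∘ c`). [folklore] -/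
private theorem ringEquiv_comp_conjugate (c : F →+* F) (hc : ∀ x : F →+* ℂ, x.comp c = ComplexEmbedding.conjugate x)
    (g : ℂ ≃+* ℂ) (x : F →+* ℂ) :
    (g : ℂ →+* ℂ).comp (ComplexEmbedding.conjugate x) = ComplexEmbedding.conjugate ((g : ℂ →+* ℂ).comp x) := by
  rw [← hc x, ← hc ((g : ℂ →+* ℂ).comp x), RingHom.comp_assoc]

/-- `Σ_ε (−1)^{|ε|} = Π_i (−1 + 1) = 0` for a nonempty index type (flipping one coordinate is a sign-reversing involution).
[folklore] -/
private theorem sum_sign_eq_zero [Nonempty ι] : ∑ ε : ι → Bool, (∏ i, (if ε i then (-1 : ℤ) else 1)) = 0 := by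
  classical
  obtain ⟨i₀⟩ := ‹Nonempty ι›
  have hsign : ∀ ε : ι → Bool, (∏ i, (if Function.update ε i₀ (!ε i₀) i then (-1 : ℤ) else 1)) =
      -∏ i, (if ε i then (-1 : ℤ) else 1) := by
    intro ε
    have h1 : (if Function.update ε i₀ (!ε i₀) i₀ then (-1 : ℤ) else 1) *
        ∏ i ∈ Finset.univ.erase i₀, (if Function.update ε i₀ (!ε i₀) i then (-1 : ℤ) else 1) =
        ∏ i, (if Function.update ε i₀ (!ε i₀) i then (-1 : ℤ) else 1) :=
      Finset.mul_prod_erase Finset.univ (fun i => if Function.update ε i₀ (!ε i₀) i then (-1 : ℤ) else 1)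
        (Finset.mem_univ i₀)
    have h2 : (if ε i₀ then (-1 : ℤ) else 1) * ∏ i ∈ Finset.univ.erase i₀, (if ε i then (-1 : ℤ) else 1) =
        ∏ i, (if ε i then (-1 : ℤ) else 1) :=
      Finset.mul_prod_erase Finset.univ (fun i => if ε i then (-1 : ℤ) else 1) (Finset.mem_univ i₀)
    have hrest : ∏ i ∈ Finset.univ.erase i₀, (if Function.update ε i₀ (!ε i₀) i then (-1 : ℤ) else 1) =
        ∏ i ∈ Finset.univ.erase i₀, (if ε i then (-1 : ℤ) else 1) :=
      Finset.prod_congr rfl fun i hi => by rw [Function.update_of_ne (Finset.ne_of_mem_erase hi)]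
    rw [← h1, ← h2, hrest, Function.update_self]
    cases ε i₀ <;> simp
  refine Finset.sum_involution (fun ε _ => Function.update ε i₀ (!ε i₀)) ?_ ?_ ?_ ?_
  · intro ε _
    rw [hsign]
    ring
  · intro ε _ _ h
    have := congr_fun h i₀
    rw [Function.update_self] at this
    cases h0 : ε i₀ <;> simp [h0] at this
  · intro ε _
    exact Finset.mem_univ _
  · intro ε _
    ext i
    by_cases hi : i = i₀
    · subst hi; simp
    · simp [hi]

omit [Fintype ι] in
/-- **All fibres have the same size**: `N(x) + N'(x) = N(x₀) + N'(x₀)` (`Aut(ℂ)` permutes the fibres transitively; the common value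
is `[K:F]`). [folklore] -/
private theorem ncard_add_ncard_eq [NumberField K] [NumberField F] (x x₀ : F →+* ℂ) :
    {φ : K →+* ℂ | φ.comp j = x ∧ φ ∈ Φ.1}.ncard + {φ : K →+* ℂ | φ.comp j = x ∧ φ ∉ Φ.1}.ncard =
      {φ : K →+* ℂ | φ.comp j = x₀ ∧ φ ∈ Φ.1}.ncard + {φ : K →+* ℂ | φ.comp j = x₀ ∧ φ ∉ Φ.1}.ncard := by
  have hfib : ∀ z : F →+* ℂ, {φ : K →+* ℂ | φ.comp j = z ∧ φ ∈ Φ.1}.ncard + {φ : K →+* ℂ | φ.comp j = z ∧ φ ∉ Φ.1}.ncard =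
      {φ : K →+* ℂ | φ.comp j = z ∧ True}.ncard := by
    intro z
    rw [← Set.ncard_union_eq (Set.disjoint_left.2 fun φ h1 h2 => h2.2 h1.2)
      (Set.toFinite _) (Set.toFinite _)]
    congr 1
    ext φ
    simp only [Set.mem_union, Set.mem_setOf_eq, and_true]
    tauto
  haveI := isPretransitive_ringEquiv_complex (K := F)
  obtain ⟨g, hg⟩ := MulAction.exists_smul_eq (ℂ ≃+* ℂ) x₀ x
  rw [ringEquiv_smul_def] at hg
  rw [hfib, hfib, ← show (g : ℂ →+* ℂ).comp x₀ = x from hg]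
  exact (ncard_fibre_comp_eq j g x₀ fun _ => True).symm

omit [Fintype ι] in
/-- Every embedding of the subfield extends (`K/F` algebraic, `ℂ` algebraically closed). [folklore] -/
private theorem fibre_nonempty [NumberField K] (x : F →+* ℂ) : ∃ φ : K →+* ℂ, φ.comp j = x := by
  letI : Algebra F K := j.toAlgebra
  letI : Algebra F ℂ := x.toAlgebra
  haveI : CharZero F := j.charZero
  haveI : IsScalarTower ℚ F K := IsScalarTower.of_algebraMap_eq fun q => (map_ratCast j q).symm
  haveI : Algebra.IsAlgebraic F K := Algebra.IsAlgebraic.tower_top (K := ℚ) F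
  let ψ : K →ₐ[F] ℂ := IsAlgClosed.lift
  exact ⟨ψ.toRingHom, ψ.comp_algebraMap⟩

/-! ### The cube -/

variable [Algebra ℚ F] [IsMulCommutative (F ≃ₐ[ℚ] F)]
  (σ : ι → (F ≃ₐ[ℚ] F)) (c : F →+* F) (hc : ∀ x : F →+* ℂ, x.comp c = ComplexEmbedding.conjugate x)
  (y : F →+* ℂ) (b : (ι → Bool) → (F →+* ℂ))
  (hb : ∀ ε : ι → Bool, b ε =
    (if (∏ i, (if ε i then (-1 : ℤ) else 1)) = 1 then y else ComplexEmbedding.conjugate y).comp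
      (∏ i, (if ε i then σ i else 1)).toRingEquiv.toRingHom)

include hc hb in
/-- **The count of §1 over the cube, term by term**: for every `ε`,
`N(g ∘ b_ε) − N'(g ∘ b_ε) = s(ε) · (N − N')((g ∘ y) ∘ σ_ε)` — for `s(ε) = 1` the base is `y ∘ σ_ε`, for `s(ε) = −1` it is
`ȳ ∘ σ_ε = \overline{y ∘ σ_ε}` and the fibre counts are exchanged (`N(x̄) = N'(x)`). [cite: Hazama2003CyclicCM, §5 (5.1)–(5.2)] -/
theorem ncard_sub_ncard_eq_sign_mul (g : ℂ ≃+* ℂ) (ε : ι → Bool) :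
    ({φ : K →+* ℂ | φ.comp j = (g : ℂ →+* ℂ).comp (b ε) ∧ φ ∈ Φ.1}.ncard : ℤ) -
        {φ : K →+* ℂ | φ.comp j = (g : ℂ →+* ℂ).comp (b ε) ∧ φ ∉ Φ.1}.ncard =
      (∏ i, (if ε i then (-1 : ℤ) else 1)) *
        (({φ : K →+* ℂ | φ.comp j = ((g : ℂ →+* ℂ).comp y).comp (∏ i, (if ε i then σ i else 1)).toRingEquiv.toRingHom ∧
            φ ∈ Φ.1}.ncard : ℤ) -
          {φ : K →+* ℂ | φ.comp j = ((g : ℂ →+* ℂ).comp y).comp (∏ i, (if ε i then σ i else 1)).toRingEquiv.toRingHom ∧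
            φ ∉ Φ.1}.ncard) := by
  rcases sign_eq_one_or ε with h | h
  · rw [hb ε, if_pos h, h, one_mul, ← RingHom.comp_assoc]
  · rw [hb ε, if_neg (by rw [h]; decide), h, neg_one_mul, neg_sub, ← RingHom.comp_assoc,
      ringEquiv_comp_conjugate c hc g y]
    have hconj : (ComplexEmbedding.conjugate ((g : ℂ →+* ℂ).comp y)).comp
        (∏ i, (if ε i then σ i else 1)).toRingEquiv.toRingHom =
        ComplexEmbedding.conjugate (((g : ℂ →+* ℂ).comp y).comp (∏ i, (if ε i then σ i else 1)).toRingEquiv.toRingHom) :=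
      RingHom.ext fun _ => rfl
    rw [hconj, ncard_conjugate_mem_eq j, ncard_conjugate_not_mem_eq j]

include hc hb in
/-- **The cube is Pohlmann-balanced iff the signed fibre counts cancel along the `Aut(ℂ)`-orbit of the base point.**  For the
cube `X(y) = {b_ε}` (`b_ε = y ∘ σ_ε` if `(−1)^{|ε|} = 1`, `ȳ ∘ σ_ε` otherwise; `ε ↦ b_ε` injective) the union of fibres
`S(y) = {φ : φ|_F ∈ X(y)}` satisfies `|gS(y) ∩ Φ| = |gS(y) ∩ Φ̄|` for all `g ∈ Aut(ℂ)` iff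
`Σ_ε (−1)^{|ε|} (N − N')((g ∘ y) ∘ σ_ε) = 0` for all `g`.  (Hazama: the odd function `ĥ = F(h)` attached to the support `h` of a
proper Hodge cycle is orthogonal to all translates of the type.) [cite: Hazama2003CyclicCM, §5 (5.1)–(5.3) and Prop. 3.2]
[cite: Pohlmann1968, Thm. 1] -/
theorem isGaloisBalanced_iff_forall_ringEquiv [NumberField K] (hinj : Function.Injective b) :
    IsGaloisBalanced Φ (Finset.univ.filter fun φ : K →+* ℂ => φ.comp j ∈ Finset.univ.image b) ↔
      ∀ g : ℂ ≃+* ℂ, ∑ ε : ι → Bool, (∏ i, (if ε i then (-1 : ℤ) else 1)) *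
        (({φ : K →+* ℂ | φ.comp j = ((g : ℂ →+* ℂ).comp y).comp (∏ i, (if ε i then σ i else 1)).toRingEquiv.toRingHom ∧
            φ ∈ Φ.1}.ncard : ℤ) -
          {φ : K →+* ℂ | φ.comp j = ((g : ℂ →+* ℂ).comp y).comp (∏ i, (if ε i then σ i else 1)).toRingEquiv.toRingHom ∧
            φ ∉ Φ.1}.ncard) = 0 := by
  rw [isGaloisBalanced_filter_comp_mem_iff j]
  refine forall_congr' fun g => ?_
  rw [Finset.sum_image fun ε _ ε' _ h => hinj h, Finset.sum_image fun ε _ ε' _ h => hinj h]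
  simp_rw [← ncard_sub_ncard_eq_sign_mul j σ c hc y b hb g]
  rw [Finset.sum_sub_distrib, sub_eq_zero]
  constructor
  · intro h; exact_mod_cast h
  · intro h; exact_mod_cast h

include hc hb in
/-- **… iff the alternating sums vanish at EVERY embedding of `F`** (the base point is immaterial): `Aut(ℂ)` acts
transitively on `Hom(F, ℂ)` (`F` a number field; tree `isPretransitive_ringEquiv_complex`), so the orbit condition of
`isGaloisBalanced_iff_forall_ringEquiv` is the condition at all `x ∈ Hom(F, ℂ)`:
`S(y)` balanced ⟺ `Σ_ε (−1)^{|ε|} (N − N')(x ∘ σ_ε) = 0` for all `x`.  In particular all cubes `S(y)`, `y ∈ Hom(F, ℂ)`, are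
Pohlmann-balanced or none is. [cite: Hazama2003CyclicCM, §5 and Prop. 3.2] [cite: Gordon1999HodgeAVSurvey, §9.2 (proof)] -/
theorem isGaloisBalanced_iff_forall_embedding [NumberField K] [NumberField F] (hinj : Function.Injective b) :
    IsGaloisBalanced Φ (Finset.univ.filter fun φ : K →+* ℂ => φ.comp j ∈ Finset.univ.image b) ↔
      ∀ x : F →+* ℂ, ∑ ε : ι → Bool, (∏ i, (if ε i then (-1 : ℤ) else 1)) *
        (({φ : K →+* ℂ | φ.comp j = x.comp (∏ i, (if ε i then σ i else 1)).toRingEquiv.toRingHom ∧ φ ∈ Φ.1}.ncard : ℤ) -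
          {φ : K →+* ℂ | φ.comp j = x.comp (∏ i, (if ε i then σ i else 1)).toRingEquiv.toRingHom ∧ φ ∉ Φ.1}.ncard) = 0 := by
  rw [isGaloisBalanced_iff_forall_ringEquiv j σ c hc y b hb hinj]
  haveI := isPretransitive_ringEquiv_complex (K := F)
  constructor
  · intro h x
    obtain ⟨g, hg⟩ := MulAction.exists_smul_eq (ℂ ≃+* ℂ) y x
    rw [ringEquiv_smul_def] at hg
    have := h g
    rwa [show (g : ℂ →+* ℂ).comp y = x from hg] at this
  · intro h g
    exact h _

include hc hb in
/-- **THE MIXED-DIFFERENCE CRITERION** (`ι` nonempty).  The cube `S(y)` over the subfield `F` is Pohlmann-balanced — i.e. for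
every realisation `A` of `(K; Φ)` the weight line of `S(y)` in `H^{|S(y)|}(A, ℂ)` consists of Hodge classes (Pohlmann's Theorem 1)
— iff the MIXED DIFFERENCES OF THE MULTIPLICITIES OF `Φ|_F` VANISH:
`Σ_ε (−1)^{|ε|} #{φ ∈ Φ : φ|_F = x ∘ σ_ε} = 0` for every `x ∈ Hom(F, ℂ)` — the field-side condition of the lane's subfield
dictionary (F66a `forall_sum_card_filter_eq_zero_iff_mixed`), equivalent for `F = K^H`, `H` of index `2^j d` with cyclic quotient and
`σ_i` through the `p`-torsion of the odd part, to `H` being an ADMISSIBLE KERNEL of the degeneracy census (F65e ∕ F66c ∕ F66j).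
Hazama's case `k = 1`, `K` cyclic of degree `2pq`, `F` of degree `2q`: the nondivisorial cycles `F⁻¹(w_k^{(2q)})` of weight `p` and
height `1` on `A` itself (Thm. 4.8 (iv)–(vi), §5). [cite: Hazama2003CyclicCM, Prop. 3.2, Thm. 4.8 (iv)–(vi), §5]
[cite: Pohlmann1968, Thm. 1] -/
theorem isGaloisBalanced_iff_forall_alternatingSum [NumberField K] [NumberField F] [Nonempty ι] (hinj : Function.Injective b) :
    IsGaloisBalanced Φ (Finset.univ.filter fun φ : K →+* ℂ => φ.comp j ∈ Finset.univ.image b) ↔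
      ∀ x : F →+* ℂ, ∑ ε : ι → Bool, (∏ i, (if ε i then (-1 : ℤ) else 1)) *
        ({φ : K →+* ℂ | φ.comp j = x.comp (∏ i, (if ε i then σ i else 1)).toRingEquiv.toRingHom ∧ φ ∈ Φ.1}.ncard : ℤ) = 0 := by
  rw [isGaloisBalanced_iff_forall_embedding j σ c hc y b hb hinj]
  -- `N' = d − N` with `d` the common fibre size, and `Σ_ε s(ε) = 0`
  set d : ℕ := {φ : K →+* ℂ | φ.comp j = y ∧ φ ∈ Φ.1}.ncard + {φ : K →+* ℂ | φ.comp j = y ∧ φ ∉ Φ.1}.ncard with hd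
  have hN' : ∀ x : F →+* ℂ, ({φ : K →+* ℂ | φ.comp j = x ∧ φ ∉ Φ.1}.ncard : ℤ) =
      (d : ℤ) - {φ : K →+* ℂ | φ.comp j = x ∧ φ ∈ Φ.1}.ncard := fun x => by
    rw [hd, ← ncard_add_ncard_eq j x y]; push_cast; ring
  refine forall_congr' fun x => ?_
  have hrw : ∑ ε : ι → Bool, (∏ i, (if ε i then (-1 : ℤ) else 1)) *
      (({φ : K →+* ℂ | φ.comp j = x.comp (∏ i, (if ε i then σ i else 1)).toRingEquiv.toRingHom ∧ φ ∈ Φ.1}.ncard : ℤ) -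
        {φ : K →+* ℂ | φ.comp j = x.comp (∏ i, (if ε i then σ i else 1)).toRingEquiv.toRingHom ∧ φ ∉ Φ.1}.ncard) =
      2 * ∑ ε : ι → Bool, (∏ i, (if ε i then (-1 : ℤ) else 1)) *
        ({φ : K →+* ℂ | φ.comp j = x.comp (∏ i, (if ε i then σ i else 1)).toRingEquiv.toRingHom ∧ φ ∈ Φ.1}.ncard : ℤ) := by
    simp_rw [hN']
    rw [Finset.mul_sum]
    have hsplit : ∀ ε : ι → Bool, (∏ i, (if ε i then (-1 : ℤ) else 1)) *
        (({φ : K →+* ℂ | φ.comp j = x.comp (∏ i, (if ε i then σ i else 1)).toRingEquiv.toRingHom ∧ φ ∈ Φ.1}.ncard : ℤ) -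
          ((d : ℤ) - {φ : K →+* ℂ | φ.comp j = x.comp (∏ i, (if ε i then σ i else 1)).toRingEquiv.toRingHom ∧ φ ∈ Φ.1}.ncard)) =
        2 * ((∏ i, (if ε i then (-1 : ℤ) else 1)) *
          ({φ : K →+* ℂ | φ.comp j = x.comp (∏ i, (if ε i then σ i else 1)).toRingEquiv.toRingHom ∧ φ ∈ Φ.1}.ncard : ℤ)) -
          (d : ℤ) * (∏ i, (if ε i then (-1 : ℤ) else 1)) := fun ε => by ring
    simp_rw [hsplit]
    rw [Finset.sum_sub_distrib, ← Finset.mul_sum, ← Finset.mul_sum, sum_sign_eq_zero, mul_zero, sub_zero]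
  rw [hrw, mul_eq_zero]
  simp

include hc hb in
/-- Membership of the cube in Pohlmann's index set: `S(y) ∈ pohlmannSets Φ m` iff `|S(y)| = 2m` and the mixed differences of the
multiplicities vanish. [cite: Pohlmann1968, Thm. 1] [cite: Hazama2003CyclicCM, Prop. 3.2 and §5] -/
theorem mem_pohlmannSets_iff [NumberField K] [NumberField F] [Nonempty ι] (hinj : Function.Injective b) (m : ℕ) :
    (Finset.univ.filter fun φ : K →+* ℂ => φ.comp j ∈ Finset.univ.image b) ∈ pohlmannSets Φ m ↔
      (Finset.univ.filter fun φ : K →+* ℂ => φ.comp j ∈ Finset.univ.image b).card = 2 * m ∧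
      ∀ x : F →+* ℂ, ∑ ε : ι → Bool, (∏ i, (if ε i then (-1 : ℤ) else 1)) *
        ({φ : K →+* ℂ | φ.comp j = x.comp (∏ i, (if ε i then σ i else 1)).toRingEquiv.toRingHom ∧ φ ∈ Φ.1}.ncard : ℤ) = 0 := by
  rw [← isGaloisBalanced_iff_forall_alternatingSum j σ c hc y b hb hinj]
  rfl

/-! ## §3 The cube is not divisorial for a primitive type; exceptional Hodge classes on every realisation -/

omit [IsMulCommutative (F ≃ₐ[ℚ] F)] [Algebra ℚ F] in
/-- **A conjugate-free union of fibres of a PRIMITIVE type is not a disjoint union of balanced pairs.**  If `Φ` is primitive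
(the balanced pairs are the conjugate pairs `{φ, φ̄}`, tree `mem_pohlmannSets_one_iff_of_isPrimitive`) and no two members of the
family of bases `b` are complex conjugate, then `S = {φ : φ|_F ∈ {b_ε}}` contains no conjugate pair with both members, so
`S ∉ pohlmannDivisorSets Φ m`: the weight class `e_S` is not in `Dᵐ ⊗ ℂ` (White's condition (a) `Δ ∩ Δ̄ = ∅`).
[cite: White1993SporadicCycles, §4 Prop. 1] [cite: Gordon1999HodgeAVSurvey, 9.2.2] -/
theorem not_mem_pohlmannDivisorSets [NumberField K] [IsCMField K] (φ₀ : K →+* ℂ) (hprim : IsPrimitive (ℂ ≃+* ℂ) Φ.1 φ₀)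
    (hfree : ∀ ε ε' : ι → Bool, b ε' ≠ ComplexEmbedding.conjugate (b ε)) (m : ℕ) :
    (Finset.univ.filter fun φ : K →+* ℂ => φ.comp j ∈ Finset.univ.image b) ∉ pohlmannDivisorSets Φ m := by
  rw [pohlmannDivisorSets_eq_of_pairs (mem_pohlmannSets_one_iff_of_isPrimitive φ₀ hprim) m]
  rintro ⟨-, hclosed⟩
  set ε₀ : ι → Bool := fun _ => false
  obtain ⟨φ, hφ⟩ := fibre_nonempty j (b ε₀)
  have hφS : φ ∈ (Finset.univ.filter fun φ : K →+* ℂ => φ.comp j ∈ Finset.univ.image b) := by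
    simp only [Finset.mem_filter, Finset.mem_univ, true_and, Finset.mem_image]
    exact ⟨ε₀, hφ.symm⟩
  have h := hclosed φ hφS
  simp only [Finset.mem_filter, Finset.mem_univ, true_and, Finset.mem_image] at h
  obtain ⟨ε', hε'⟩ := h
  refine hfree ε₀ ε' ?_
  rw [hε', conjugate_comp, hφ]

include hc hb in
/-- **EXCEPTIONAL HODGE CLASSES FROM AN ADMISSIBLE KERNEL, ON `A` ITSELF.**  Let `Φ` be a PRIMITIVE CM type of `K`, `F ⊆ K` a subfield
with complex conjugation `c` and commuting automorphisms `σ_i` (`i ∈ ι ≠ ∅`), `y` an embedding of `F` whose cube `{b_ε}` is injective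
and conjugate-free, and suppose the mixed differences of the multiplicities of `Φ|_F` along the `σ_i` vanish at every embedding
(for `F = K^H` in an abelian CM field: `H` an admissible kernel of the degeneracy census).  Then EVERY realisation `(A, ι_A, θ)` of
`(K; Φ)` read on `H¹` carries a rational class of Hodge type `(m, m)`, `2m = |S(y)|` (`= 2^k [K:F]`), OUTSIDE the complexified
divisor ring `Dᵐ(A) ⊗ ℂ` — the weight class of the cube `S(y)` (Pohlmann's criterion `exists_exceptional_iff`).  Hazama, `k = 1`:
the nondivisorial cycles of codimension `p` on the `p`-dominated abelian varieties of a cyclic CM field of degree `2pq`.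
[cite: Hazama2003CyclicCM, Thm. 4.8 (iv)–(vi) and §5] [cite: Pohlmann1968, Thm. 1] [cite: Gordon1999HodgeAVSurvey, 9.2.2] -/
theorem exists_exceptional [NumberField K] [IsCMField K] [NumberField F] [Nonempty ι] (hinj : Function.Injective b)
    (hfree : ∀ ε ε' : ι → Bool, b ε' ≠ ComplexEmbedding.conjugate (b ε))
    (φ₀ : K →+* ℂ) (hprim : IsPrimitive (ℂ ≃+* ℂ) Φ.1 φ₀)
    (halt : ∀ x : F →+* ℂ, ∑ ε : ι → Bool, (∏ i, (if ε i then (-1 : ℤ) else 1)) *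
      ({φ : K →+* ℂ | φ.comp j = x.comp (∏ i, (if ε i then σ i else 1)).toRingEquiv.toRingHom ∧ φ ∈ Φ.1}.ncard : ℤ) = 0)
    {A : AbelianVariety ℂ} {ιA : 𝓞 K →+* End A} {θ : K →+* Module.End ℂ (complexBetti A.X 1)}
    (hA : IsCMTypeRealisation Φ A ιA θ) :
    ∃ m : ℕ, (Finset.univ.filter fun φ : K →+* ℂ => φ.comp j ∈ Finset.univ.image b).card = 2 * m ∧
      ∃ cl : complexBetti A.X (2 * m), IsRationalClass cl ∧
        IsOfHodgeType (Module.finrank ℚ K / 2) A.X (2 * m) m m cl ∧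
        cl ∉ divisorClassesSpan A.X (Module.finrank ℚ K / 2) m := by
  have hbal := (isGaloisBalanced_iff_forall_alternatingSum j σ c hc y b hb hinj).2 halt
  refine ⟨_, hbal.card_eq_two_mul, (exists_exceptional_iff hA _).2 ⟨_, ⟨hbal.card_eq_two_mul, hbal⟩,
    not_mem_pohlmannDivisorSets j b φ₀ hprim hfree _⟩⟩

include hc hb in
/-- The same, read as a count: under the hypotheses of `exists_exceptional`, `dim Bᵐ(A) − dim Dᵐ(A) ≥ 1` at `2m = |S(y)|`
(White–Gordon: the difference counts the balanced `2m`-sets that are not disjoint unions of balanced pairs).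
[cite: Gordon1999HodgeAVSurvey, 9.2.2] [cite: Hazama2003CyclicCM, Thm. 4.8 (iv)–(vi)] -/
theorem one_le_finrank_sub [NumberField K] [IsCMField K] [NumberField F] [Nonempty ι] (hinj : Function.Injective b)
    (hfree : ∀ ε ε' : ι → Bool, b ε' ≠ ComplexEmbedding.conjugate (b ε))
    (φ₀ : K →+* ℂ) (hprim : IsPrimitive (ℂ ≃+* ℂ) Φ.1 φ₀)
    (halt : ∀ x : F →+* ℂ, ∑ ε : ι → Bool, (∏ i, (if ε i then (-1 : ℤ) else 1)) *
      ({φ : K →+* ℂ | φ.comp j = x.comp (∏ i, (if ε i then σ i else 1)).toRingEquiv.toRingHom ∧ φ ∈ Φ.1}.ncard : ℤ) = 0)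
    {A : AbelianVariety ℂ} {ιA : 𝓞 K →+* End A} {θ : K →+* Module.End ℂ (complexBetti A.X 1)}
    (hA : IsCMTypeRealisation Φ A ιA θ) :
    1 ≤ Module.finrank ℂ ↥(hodgeClassSpan (Module.finrank ℚ K / 2) A.X
          {s | s ∈ (Finset.univ.filter fun φ : K →+* ℂ => φ.comp j ∈ Finset.univ.image b) ∧ s ∈ Φ.1}.ncard) -
        Module.finrank ℂ ↥(divisorClassesSpan A.X (Module.finrank ℚ K / 2)
          {s | s ∈ (Finset.univ.filter fun φ : K →+* ℂ => φ.comp j ∈ Finset.univ.image b) ∧ s ∈ Φ.1}.ncard) := by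
  have hbal := (isGaloisBalanced_iff_forall_alternatingSum j σ c hc y b hb hinj).2 halt
  rw [finrank_hodgeClassSpan_sub_finrank_divisorClassesSpan hA]
  exact Nat.succ_le_of_lt ((Set.ncard_pos (Set.toFinite _)).2
    ⟨_, ⟨hbal.card_eq_two_mul, hbal⟩, not_mem_pohlmannDivisorSets j b φ₀ hprim hfree _⟩)

/-! ## §4 The CM-field form: `c` = complex conjugation of `F` -/

omit [Fintype ι] [Algebra ℚ F] [IsMulCommutative (F ≃ₐ[ℚ] F)] in
/-- For a CM field `F`, Mathlib's complex conjugation `IsCMField.complexConj F` induces conjugation in every embedding: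
`x ∘ c = x̄`. [folklore] -/
private theorem comp_complexConj_eq_conjugate [NumberField F] [IsCMField F] (x : F →+* ℂ) :
    x.comp (IsCMField.complexConj F).toRingEquiv.toRingHom = ComplexEmbedding.conjugate x :=
  RingHom.ext fun a => by
    rw [RingHom.comp_apply, ComplexEmbedding.conjugate_coe_eq]
    exact IsCMField.complexEmbedding_complexConj (K := F) x a

include hb in
/-- **The criterion for a CM subfield** (`c` = `IsCMField.complexConj F`): the cube `S(y)` of commuting automorphisms `σ_i` of the CM
field `F ⊆ K` is Pohlmann-balanced iff the mixed differences `Σ_ε (−1)^{|ε|} #{φ ∈ Φ : φ|_F = x ∘ σ_ε}` vanish for all `x`.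
[cite: Hazama2003CyclicCM, Prop. 3.2, Thm. 4.8 (iv)–(vi), §5] [cite: Pohlmann1968, Thm. 1] -/
theorem isGaloisBalanced_iff_forall_alternatingSum_of_isCMField [NumberField K] [NumberField F] [IsCMField F] [Nonempty ι]
    (hinj : Function.Injective b) :
    IsGaloisBalanced Φ (Finset.univ.filter fun φ : K →+* ℂ => φ.comp j ∈ Finset.univ.image b) ↔
      ∀ x : F →+* ℂ, ∑ ε : ι → Bool, (∏ i, (if ε i then (-1 : ℤ) else 1)) *
        ({φ : K →+* ℂ | φ.comp j = x.comp (∏ i, (if ε i then σ i else 1)).toRingEquiv.toRingHom ∧ φ ∈ Φ.1}.ncard : ℤ) = 0 :=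
  isGaloisBalanced_iff_forall_alternatingSum j σ (IsCMField.complexConj F).toRingEquiv.toRingHom
    comp_complexConj_eq_conjugate y b hb hinj

/-! ## §5 (gen 67 append) The conjugate cube and `dim Bᵐ(A) − dim Dᵐ(A) ≥ 2` -/

include hb in
/-- **The conjugate family is the cube of the conjugate base**: `\overline{b_ε} = (s(ε) = 1 ? ȳ : y) ∘ σ_ε`, i.e. the family `b` for the base
`ȳ` (with `\overline{ȳ} = y`). [cite: Hazama2003CyclicCM, §5 (5.1)–(5.2)] -/
theorem conjugate_cube_eq (ε : ι → Bool) :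
    ComplexEmbedding.conjugate (b ε) =
      (if (∏ i, (if ε i then (-1 : ℤ) else 1)) = 1 then ComplexEmbedding.conjugate y
        else ComplexEmbedding.conjugate (ComplexEmbedding.conjugate y)).comp
        (∏ i, (if ε i then σ i else 1)).toRingEquiv.toRingHom := by
  rw [hb ε]
  split_ifs <;> exact RingHom.ext fun _ => rfl

omit [Algebra ℚ F] [IsMulCommutative (F ≃ₐ[ℚ] F)] in
/-- **The union of fibres over the conjugate family is the conjugate of the union of fibres**: `S(\overline{B}) = \overline{S(B)}`.
[cite: Hazama2003CyclicCM, §5] [cite: Gordon1999HodgeAVSurvey, §9.2] -/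
theorem filter_comp_mem_image_conjugate [NumberField K] (b₀ : (ι → Bool) → (F →+* ℂ)) :
    (Finset.univ.filter fun φ : K →+* ℂ => φ.comp j ∈ Finset.univ.image fun ε => ComplexEmbedding.conjugate (b₀ ε)) =
      (Finset.univ.filter fun φ : K →+* ℂ => φ.comp j ∈ Finset.univ.image b₀).image ComplexEmbedding.conjugate := by
  ext φ
  simp only [Finset.mem_filter, Finset.mem_univ, true_and, Finset.mem_image]
  constructor
  · rintro ⟨ε, hε⟩
    refine ⟨ComplexEmbedding.conjugate φ, ⟨ε, ?_⟩, ComplexEmbedding.involutive_conjugate K φ⟩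
    rw [conjugate_comp, ← hε]
    exact (ComplexEmbedding.involutive_conjugate F (b₀ ε)).symm
  · rintro ⟨ψ, ⟨ε, hε⟩, rfl⟩
    exact ⟨ε, by rw [conjugate_comp, ← hε]⟩

include hc hb in
/-- **`dim Bᵐ(A) − dim Dᵐ(A) ≥ 2` at `2m = |S(y)|`**: under the hypotheses of `exists_exceptional`, the cube `S(y)` and its conjugate
`\overline{S(y)} = S(ȳ)` (the cube of the base `ȳ`, injective and conjugate-free with `b`, balanced by the same mixed-difference
criterion, and different from `S(y)` because `ȳ ∉ {b_ε}`) are two distinct balanced `2m`-sets that are not disjoint unions of balanced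
pairs — so they span two independent lines of Hodge classes outside `Dᵐ ⊗ ℂ` (Pohlmann's count
`finrank_hodgeClassSpan_sub_finrank_divisorClassesSpan`; the analogue for cubes of `WeilTypeCMSubfieldExceptionalClasses`'s count for fibres).
[cite: Gordon1999HodgeAVSurvey, 9.2.2] [cite: Hazama2003CyclicCM, Thm. 4.8 (iv)–(vi), §5] [cite: White1993SporadicCycles, §4 Prop. 1] -/
theorem two_le_finrank_sub [NumberField K] [IsCMField K] [NumberField F] [Nonempty ι] (hinj : Function.Injective b)
    (hfree : ∀ ε ε' : ι → Bool, b ε' ≠ ComplexEmbedding.conjugate (b ε))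
    (φ₀ : K →+* ℂ) (hprim : IsPrimitive (ℂ ≃+* ℂ) Φ.1 φ₀)
    (halt : ∀ x : F →+* ℂ, ∑ ε : ι → Bool, (∏ i, (if ε i then (-1 : ℤ) else 1)) *
      ({φ : K →+* ℂ | φ.comp j = x.comp (∏ i, (if ε i then σ i else 1)).toRingEquiv.toRingHom ∧ φ ∈ Φ.1}.ncard : ℤ) = 0)
    {A : AbelianVariety ℂ} {ιA : 𝓞 K →+* End A} {θ : K →+* Module.End ℂ (complexBetti A.X 1)}
    (hA : IsCMTypeRealisation Φ A ιA θ) :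
    2 ≤ Module.finrank ℂ ↥(hodgeClassSpan (Module.finrank ℚ K / 2) A.X
          {s | s ∈ (Finset.univ.filter fun φ : K →+* ℂ => φ.comp j ∈ Finset.univ.image b) ∧ s ∈ Φ.1}.ncard) -
        Module.finrank ℂ ↥(divisorClassesSpan A.X (Module.finrank ℚ K / 2)
          {s | s ∈ (Finset.univ.filter fun φ : K →+* ℂ => φ.comp j ∈ Finset.univ.image b) ∧ s ∈ Φ.1}.ncard) := by
  have hbal := (isGaloisBalanced_iff_forall_alternatingSum j σ c hc y b hb hinj).2 halt
  -- the conjugate cube: base `ȳ`, family `b' = \overline{b}`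
  set b' : (ι → Bool) → (F →+* ℂ) := fun ε => ComplexEmbedding.conjugate (b ε) with hb'def
  have hb' : ∀ ε : ι → Bool, b' ε =
      (if (∏ i, (if ε i then (-1 : ℤ) else 1)) = 1 then ComplexEmbedding.conjugate y
        else ComplexEmbedding.conjugate (ComplexEmbedding.conjugate y)).comp
        (∏ i, (if ε i then σ i else 1)).toRingEquiv.toRingHom := fun ε => conjugate_cube_eq σ y b hb ε
  have hinj' : Function.Injective b' := fun ε ε' h =>
    hinj ((ComplexEmbedding.involutive_conjugate F).injective h)
  have hfree' : ∀ ε ε' : ι → Bool, b' ε' ≠ ComplexEmbedding.conjugate (b' ε) := by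
    intro ε ε' h
    refine hfree ε' ε ?_
    have h' := congrArg ComplexEmbedding.conjugate h
    simp only [hb'def, ComplexEmbedding.involutive_conjugate F _] at h'
    rw [h']
    exact (ComplexEmbedding.involutive_conjugate F (b ε)).symm
  have hbal' := (isGaloisBalanced_iff_forall_alternatingSum j σ c hc (ComplexEmbedding.conjugate y) b' hb' hinj').2 halt
  set S := Finset.univ.filter fun φ : K →+* ℂ => φ.comp j ∈ Finset.univ.image b with hSdef
  set S' := Finset.univ.filter fun φ : K →+* ℂ => φ.comp j ∈ Finset.univ.image b' with hS'def
  have hS'S : S' = S.image ComplexEmbedding.conjugate := filter_comp_mem_image_conjugate j b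
  have hcard : S'.card = S.card := by
    rw [hS'S, Finset.card_image_of_injective _ (ComplexEmbedding.involutive_conjugate K).injective]
  -- `S ≠ S'`: an extension `φ` of `b'_0 = \overline{b_0}` lies in `S'` but not in `S` (`\overline{b_0} ∉ {b_ε}` by conjugate-freeness)
  have hne : S ≠ S' := by
    obtain ⟨φ, hφ⟩ := fibre_nonempty j (b' fun _ => false)
    intro hSS
    have hφS' : φ ∈ S' := by
      simp only [hS'def, Finset.mem_filter, Finset.mem_univ, true_and, Finset.mem_image]
      exact ⟨_, hφ.symm⟩
    rw [← hSS] at hφS'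
    simp only [hSdef, Finset.mem_filter, Finset.mem_univ, true_and, Finset.mem_image] at hφS'
    obtain ⟨ε, hε⟩ := hφS'
    refine hfree (fun _ => false) ε ?_
    rw [hε, hφ, hb'def]
  rw [finrank_hodgeClassSpan_sub_finrank_divisorClassesSpan hA]
  refine Nat.succ_le_of_lt ((Set.one_lt_ncard_iff (Set.toFinite _)).2 ⟨S, S', ?_, ?_, hne⟩)
  · exact ⟨⟨hbal.card_eq_two_mul, hbal⟩, not_mem_pohlmannDivisorSets j b φ₀ hprim hfree _⟩
  · refine ⟨⟨?_, hbal'⟩, not_mem_pohlmannDivisorSets j b' φ₀ hprim hfree' _⟩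
    rw [hcard]
    exact hbal.card_eq_two_mul

end Cube

end MixedDifferenceCube

end Literature.AlgebraicGeometry.Pohlmann1968

end
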